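import Mathlib
import HarnessLib
import Summits.NavierStokesRegularity.NavierStokesRegularity.Theorems.HalfSpaceWindowDoorCirculationCarryingRigidityAngularMeanDrift
import Summits.NavierStokesRegularity.NavierStokesRegularity.Theorems.HalfSpaceWindowDoorCirculationCarryingRigidityHemisphereSupport

/-!
# Route `HalfSpaceWindowDoor`, crux `CirculationCarryingRigidity` (stmt-NavierStokesRegularity-25311) — census theorem
# `eddy_torque`: closed-hemisphere axis-Type-I profiles whose EDDY TORQUE about the apex axis is slaved to the mean vertical
# vorticity are POLOIDAL (the conclusion of the open stub `HemisphereLiouvilleE3` on this stratum)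

Line `eddy_torque` (LEAD ns-hsw-p1 g4).  THEOREM (`inner_curl_e3_eq_zero_of_axisTypeI_remainder_le`, unconditional): a
profile of the door's Type-I ancient Oseen-mild class with (i) the AXIS-Type-I bound `‖v(t,x)‖ ≤ D/(|x_h| + √(−t))` (implied by
`HasTypeIDecay`), (ii) the sign `⟪curl v, e₃⟫ ≥ 0`, and (iii) the EDDY-TORQUE condition on the planner's fluctuation
remainder `ℛ(r,z,s) = ∮_{S(r,z)} [(v_z − v̄_z) ω_r − (v_r − v̄_r) ω₃] dl` of the circle-averaged swirl law (AxisTwistDoor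
`…Defs.remainder`; minus the net torque of the non-axisymmetric modes on the axis circle,
`−ℛ = (1/r)∂_r(r² ∮v'_r v'_θ dθ) + ∂_z(r ∮v'_z v'_θ dθ)`; zero for axisymmetric fields):
`|ℛ| ≤ A/(r + √(−s)) · ∮_{S(r,z)} ω₃ dl` for all `r > 0`, `z`, `s < 0` — is POLOIDAL: `⟪curl v, e₃⟫ ≡ 0` on the slab.

PROOF.  `F = (2π)⁻¹Γ` with the ANGULAR-MEAN drift `⟨v⟩_θ` (`…AngularMeanDrift`) and the extra radial drift `β = −ℛ/∮ω₃ dl`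
(`|β| r ≤ A`, `|β|√(−s) ≤ A`) is a sourced swirl triple (`isSourcedSwirl_circF_drift`; the circle law in remainder form reads
`∂ₛF = ΔF − (2/r)∂ᵣF − DF[⟨v⟩_θ] + (2π)⁻¹ℛ`); the crux's sourced swirl Liouville theorem (g3, KNSS 2009 Thm 5.3 with source)
gives `Γ ≡ 0`, so `∮ω₃ dl = ∂ᵣΓ ≡ 0`, so `ω₃ = 0` on the open half-space `{y₁ > 0}` of every slice (sign + continuity), so
everywhere by unique continuation (`…HemisphereSupport.inner_curl_e3_eq_zero_of_open`).

CENSUS MEANING (25311; also AxisTwistDoor's residue 26991).  The hypothesis follows from g3's circle-averaged cone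
(`∮|ω_h| ≤ K∮ω₃` ⇒ `|ℛ| ≤ 2(1+K)·D/(r+√(−s))·∮ω₃`), so this generalises `…AxisTypeILiouville` (which, having the cone,
concludes `v ≡ 0`; here only poloidality — regularity of poloidal profiles is crux 19708).  NEW DEAD STRATUM: all MEAN
(m = 0) structure is harmless — mean radial tilt `∮ω_r dl = −Γ_z` of any size and any mean meridional flow are absorbed by
the divergence-free drift `⟨v⟩_θ`; only eddy torque NOT controlled by `∮ω₃ dl` can carry a circulation-carrying profile.
In particular `ℛ ≡ 0` (e.g. AXISYMMETRIC SWIRL `v_θ` with arbitrarily twisted `v_r, v_z`) ⇒ poloidal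
(`inner_curl_e3_eq_zero_of_axisTypeI_remainder_eq_zero`).

Seat ns-hsw-p1 g4 (LEAD of 25311, cell pub-ns-dss).  WHAT THIS IS NOT: not a statement about Navier–Stokes regularity
(Clay A): a Liouville-type theorem about HYPOTHETICAL blow-up profiles; the crux, its stub and NS regularity remain OPEN;
helper `--supports` 25311.
-/

noncomputable section

-- the summit and its single sub-problem share the name (CONVENTIONS §1), as in every Theorems file
set_option linter.dupNamespace false

namespace Summit.NavierStokesRegularity.NavierStokesRegularity.Theorems.HalfSpaceWindowDoorCirculationCarryingRigidityEddyTorqueLiouville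

open MeasureTheory Set Function Filter Topology TopologicalSpace InnerProductSpace WithLp Metric
open scoped Laplacian RealInnerProductSpace ContDiff Classical
open Literature.Analysis Literature.Analysis.FluidPDE
open Summit.NavierStokesRegularity.NavierStokesRegularity.Theorems.HalfSpaceWindowDoorCirculationCarryingRigidityDefs (IsSourcedSwirl)
open Summit.NavierStokesRegularity.NavierStokesRegularity.Theorems.AxisTwistDoorAveragedConeLiouvilleDefs
  (cylPt eT e3 circ vortCirc radVortCirc tiltCirc circleTerm meanR meanZ remainder SignE3 GlobalCone)
open Summit.NavierStokesRegularity.NavierStokesRegularity.Theorems.AveragedConeLiouville.CircleStokes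
  (deriv_circ_eq_vortCirc continuous_eR inner_e3)
open Summit.NavierStokesRegularity.NavierStokesRegularity.Theorems.AveragedConeLiouville.CircMonotone
  (circ_zero vortCirc_zero vortCirc_nonneg circ_nonneg)
open Summit.NavierStokesRegularity.NavierStokesRegularity.Theorems.AveragedConeLiouville.FlatFlux
  (eq_zero_of_integral_eq_zero_of_nonneg exists_cylPt_eq)
open Summit.NavierStokesRegularity.NavierStokesRegularity.Theorems.AveragedConeLiouville.ShellBookkeeping (cylRadius_cylPt)
open Summit.NavierStokesRegularity.NavierStokesRegularity.Theorems.AxisTwistDoorAveragedConeLiouvilleCylFrame (continuous_cylPt_θ)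
open Summit.NavierStokesRegularity.NavierStokesRegularity.Theorems.HalfSpaceWindowDoorCirculationCarryingRigidityAxisCirculation
open Summit.NavierStokesRegularity.NavierStokesRegularity.Theorems.HalfSpaceWindowDoorCirculationCarryingRigidityAxisCirculationDynamics
open Summit.NavierStokesRegularity.NavierStokesRegularity.Theorems.HalfSpaceWindowDoorCirculationCarryingRigiditySourcedSwirlLiouville
open Summit.NavierStokesRegularity.NavierStokesRegularity.Theorems.HalfSpaceWindowDoorCirculationCarryingRigidityAxisTypeILiouville
  (axisBound_nonneg abs_circF_le_of_axisBound axisBound_of_hasTypeIDecay)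
open Summit.NavierStokesRegularity.NavierStokesRegularity.Theorems.HalfSpaceWindowDoorCirculationCarryingRigidityHemisphereSupport
  (inner_curl_e3_eq_zero_of_open)
open Summit.NavierStokesRegularity.NavierStokesRegularity.Theorems.HalfSpaceWindowDoorCirculationCarryingRigidityAngularMeanDrift

variable {C D A : ℝ} {v : ℝ → EuclideanSpace ℝ (Fin 3) → EuclideanSpace ℝ (Fin 3)}

/-- **The time-integrated sourced swirl equation for `F = (2π)⁻¹Γ` with the angular-mean drift** off the axis: for any
coefficient `β` with `β ∮ω₃ dl = −ℛ` (the fluctuation remainder) at negative times, and `s ≤ t < 0`,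
`F(t,x) − F(s,x) = ∫ₛᵗ (ΔF − DF[⟨v(σ)⟩_θ(x)] − (2/r + β) ∂ᵣF) dσ`. -/
theorem circF_eqn_drift (hrate : HasTypeITimeDecay C v)
    (hcont : ContinuousOn (uncurry v) (Iio (0 : ℝ) ×ˢ univ))
    (hmild : ∀ s t : ℝ, s < t → t < 0 → ∀ x,
      v t x = UnboundedOperators.heatExtension (v s) (t - s) x - oseenDuhamel 1 s v v t x)
    (hdiv : ∀ t < 0, VectorCalculus.IsDivFree (v t))
    {β : ℝ → EuclideanSpace ℝ (Fin 3) → ℝ}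
    (hβR : ∀ s < 0, ∀ x : EuclideanSpace ℝ (Fin 3),
      β s x * vortCirc v (cylRadius x) (x 2) s = -remainder v (cylRadius x) (x 2) s)
    {x : EuclideanSpace ℝ (Fin 3)} (hx : cylRadius x ≠ 0) {s t : ℝ} (hst : s ≤ t) (ht : t < 0) :
    (2 * Real.pi)⁻¹ * circ v (cylRadius x) (x 2) t - (2 * Real.pi)⁻¹ * circ v (cylRadius x) (x 2) s =
      ∫ σ in s..t, ((Δ (fun y : EuclideanSpace ℝ (Fin 3) => (2 * Real.pi)⁻¹ * circ v (cylRadius y) (y 2) σ)) x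
        - fderiv ℝ (fun y : EuclideanSpace ℝ (Fin 3) => (2 * Real.pi)⁻¹ * circ v (cylRadius y) (y 2) σ) x
            ((fun (σ' : ℝ) (y : EuclideanSpace ℝ (Fin 3)) => if σ' < 0 then angularMeanVec (v σ') y else 0) σ x)
        - (2 / cylRadius x + β σ x) *
          partialDeriv (eR x) (fun y : EuclideanSpace ℝ (Fin 3) => (2 * Real.pi)⁻¹ * circ v (cylRadius y) (y 2) σ) x) := by
  have hsm : IsSmoothSpaceTimeOn (Iio (0 : ℝ)) v := isSmoothSpaceTimeOn_of_class hrate hcont hmild hdiv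
  have hSF := isSmoothSpaceTimeOn_circF hsm
  have hr : 0 < cylRadius x := lt_of_le_of_ne (cylRadius_nonneg x) (Ne.symm hx)
  have hσneg : ∀ σ ∈ uIcc s t, σ < 0 := by
    intro σ hσ; rw [uIcc_of_le hst] at hσ; exact lt_of_le_of_lt hσ.2 ht
  set R : ℝ → ℝ := fun σ => meanR v (cylRadius x) (x 2) σ with hR
  set Z : ℝ → ℝ := fun σ => meanZ v (cylRadius x) (x 2) σ with hZ
  set W : ℝ → ℝ := fun σ => vortCirc v (cylRadius x) (x 2) σ with hW
  set Q : ℝ → ℝ := fun σ => radVortCirc v (cylRadius x) (x 2) σ with hQ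
  set Rm : ℝ → ℝ := fun σ => remainder v (cylRadius x) (x 2) σ with hRm
  -- the continuous form of the integrand
  set H : ℝ → ℝ := fun σ =>
    (Δ (fun y : EuclideanSpace ℝ (Fin 3) => (2 * Real.pi)⁻¹ * circ v (cylRadius y) (y 2) σ)) x
      - (2 * Real.pi)⁻¹ * (R σ * W σ - Z σ * Q σ)
      - 2 / cylRadius x * ((2 * Real.pi)⁻¹ * W σ)
      + (2 * Real.pi)⁻¹ * Rm σ with hH
  have hGH : ∀ σ, σ < 0 →
      (Δ (fun y : EuclideanSpace ℝ (Fin 3) => (2 * Real.pi)⁻¹ * circ v (cylRadius y) (y 2) σ)) x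
        - fderiv ℝ (fun y : EuclideanSpace ℝ (Fin 3) => (2 * Real.pi)⁻¹ * circ v (cylRadius y) (y 2) σ) x
            ((fun (σ' : ℝ) (y : EuclideanSpace ℝ (Fin 3)) => if σ' < 0 then angularMeanVec (v σ') y else 0) σ x)
        - (2 / cylRadius x + β σ x) *
          partialDeriv (eR x) (fun y : EuclideanSpace ℝ (Fin 3) => (2 * Real.pi)⁻¹ * circ v (cylRadius y) (y 2) σ) x
        = H σ := by
    intro σ hσ
    have hdrift : (fun (σ' : ℝ) (y : EuclideanSpace ℝ (Fin 3)) => if σ' < 0 then angularMeanVec (v σ') y else 0) σ x =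
        angularMeanVec (v σ) x := by simp only [if_pos hσ]
    rw [hH, hdrift, fderiv_circF_angularMeanVec hsm hσ hx, partialDeriv_apply, fderiv_circF_eR hsm hσ x]
    have hb := hβR σ hσ x
    simp only
    have : β σ x * ((2 * Real.pi)⁻¹ * vortCirc v (cylRadius x) (x 2) σ) =
        -((2 * Real.pi)⁻¹ * remainder v (cylRadius x) (x 2) σ) := by
      rw [← mul_assoc, mul_comm (β σ x), mul_assoc, hb]; ring
    rw [add_mul, this]
    ring
  -- continuity of `H` on `[s, t]`
  have hIcc : MapsTo (fun σ : ℝ => ((cylRadius x, x 2, σ) : ℝ × ℝ × ℝ)) (uIcc s t) {q : ℝ × ℝ × ℝ | q.2.2 < 0} :=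
    fun σ hσ => hσneg σ hσ
  have hcq : Continuous fun σ : ℝ => ((cylRadius x, x 2, σ) : ℝ × ℝ × ℝ) := by fun_prop
  have hIcc' : MapsTo (fun σ : ℝ => ((σ, x) : ℝ × EuclideanSpace ℝ (Fin 3))) (uIcc s t) (Iio (0 : ℝ) ×ˢ univ) :=
    fun σ hσ => ⟨hσneg σ hσ, mem_univ _⟩
  have hcσ : Continuous fun σ : ℝ => ((σ, x) : ℝ × EuclideanSpace ℝ (Fin 3)) := by fun_prop
  have hcomp : ∀ {g : ℝ → ℝ → ℝ → ℝ},
      ContinuousOn (fun q : ℝ × ℝ × ℝ => g q.1 q.2.1 q.2.2) {q | q.2.2 < 0} →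
        ContinuousOn (fun σ => g (cylRadius x) (x 2) σ) (uIcc s t) := by
    intro g hg
    have h := hg.comp hcq.continuousOn hIcc
    simpa only [Function.comp_def] using h
  have hRc : ContinuousOn R (uIcc s t) := hcomp (continuousOn_meanR hsm)
  have hZc : ContinuousOn Z (uIcc s t) := hcomp (continuousOn_meanZ hsm)
  have hWc : ContinuousOn W (uIcc s t) := hcomp (continuousOn_vortCirc hsm)
  have hQc : ContinuousOn Q (uIcc s t) := hcomp (continuousOn_radVortCirc hsm)
  have hRmc : ContinuousOn Rm (uIcc s t) := hcomp (continuousOn_remainder hsm)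
  have hHc : ContinuousOn H (uIcc s t) := by
    have h1 : ContinuousOn (fun σ =>
        (Δ (fun y : EuclideanSpace ℝ (Fin 3) => (2 * Real.pi)⁻¹ * circ v (cylRadius y) (y 2) σ)) x) (uIcc s t) := by
      have h := ((hSF.laplacian (uniqueDiffOn_Iio 0)).continuousOn).comp hcσ.continuousOn hIcc'
      simpa only [Function.comp_def, Function.uncurry_apply_pair] using h
    exact ((h1.sub (continuousOn_const.mul ((hRc.mul hWc).sub (hZc.mul hQc)))).sub
      (continuousOn_const.mul (continuousOn_const.mul hWc))).add (continuousOn_const.mul hRmc)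
  -- the pointwise time derivative
  have hderiv : ∀ σ ∈ uIcc s t, HasDerivAt (fun σ' => (2 * Real.pi)⁻¹ * circ v (cylRadius x) (x 2) σ') (H σ) σ := by
    intro σ hσ
    have hσ0 := hσneg σ hσ
    have h := hasDerivAt_circF_time hsm hσ0 x
    have hv1 : ContDiff ℝ 1 (v σ) := (hsm.contDiff_slice hσ0).of_le (by norm_cast)
    have hd := deriv_circ_s_eq_remainder hrate hcont hmild hdiv hσ0 hr (x 2)
    have hlap := laplacian_circF hsm hσ0 hx
    have hvr := deriv_circ_eq_vortCirc v hv1 (cylRadius x) (x 2)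
    have e : (2 * Real.pi)⁻¹ * deriv (fun s' => circ v (cylRadius x) (x 2) s') σ = H σ := by
      rw [hH, hd]
      simp only [hR, hZ, hW, hQ, hRm]
      rw [hlap, hvr]
      field_simp
      ring
    rw [← e]
    exact h
  have hint : IntervalIntegrable H volume s t := (hHc.mono le_rfl).intervalIntegrable
  have hFTC := intervalIntegral.integral_eq_sub_of_hasDerivAt hderiv hint
  rw [← hFTC]
  refine intervalIntegral.integral_congr fun σ hσ => ?_
  exact (hGH σ (hσneg σ hσ)).symm


/-- **`(F, ⟨v⟩_θ, β)` is a sourced swirl triple** with `C_f = D`, `C_u = D`, extra-drift constant `A`, `τ = 0`, for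
`F(s,x) = (2π)⁻¹Γ(|x_h|,x₃,s)`, the angular-mean drift `⟨v(s)⟩_θ` (zero at non-negative times) and any jointly measurable `β`
with `β ∮ω₃ dl = −ℛ` and `|β| ≤ A/(|x_h| + √(−s))` at every `s < 0`, under the axis-Type-I bound and the closed-hemisphere
sign. -/
theorem isSourcedSwirl_circF_drift (hrate : HasTypeITimeDecay C v)
    (hcont : ContinuousOn (uncurry v) (Iio (0 : ℝ) ×ˢ univ))
    (hmild : ∀ s t : ℝ, s < t → t < 0 → ∀ x,
      v t x = UnboundedOperators.heatExtension (v s) (t - s) x - oseenDuhamel 1 s v v t x)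
    (hdiv : ∀ t < 0, VectorCalculus.IsDivFree (v t))
    (hDax : ∀ t < 0, ∀ x : EuclideanSpace ℝ (Fin 3), ‖v t x‖ ≤ D / (cylRadius x + Real.sqrt (-t)))
    (hsign : SignE3 v) (hA : 0 ≤ A)
    {β : ℝ → EuclideanSpace ℝ (Fin 3) → ℝ} (hβm : Measurable (uncurry β))
    (hβR : ∀ s < 0, ∀ x : EuclideanSpace ℝ (Fin 3),
      β s x * vortCirc v (cylRadius x) (x 2) s = -remainder v (cylRadius x) (x 2) s)
    (hβle : ∀ s < 0, ∀ x : EuclideanSpace ℝ (Fin 3), |β s x| ≤ A / (cylRadius x + Real.sqrt (-s))) :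
    IsSourcedSwirl D D A 0
      (fun s (x : EuclideanSpace ℝ (Fin 3)) => (2 * Real.pi)⁻¹ * circ v (cylRadius x) (x 2) s)
      (fun (s : ℝ) (x : EuclideanSpace ℝ (Fin 3)) => if s < 0 then angularMeanVec (v s) x else 0) β := by
  have hsm : IsSmoothSpaceTimeOn (Iio (0 : ℝ)) v := isSmoothSpaceTimeOn_of_class hrate hcont hmild hdiv
  have hSF := isSmoothSpaceTimeOn_circF hsm
  refine ⟨?_, ?_, ?_, ?_, ?_, ?_, ?_, measurable_meanDrift hcont, ?_, ?_, ?_, hβm, hA, ?_, ?_, ?_⟩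
  · intro t ht; exact contDiff_circF (hsm.contDiff_slice ht)
  · exact hSF.continuousOn_fderiv_slice (uniqueDiffOn_Iio 0)
  · exact (hSF.laplacian (uniqueDiffOn_Iio 0)).continuousOn
  · intro t _; exact isAxisymmetricScalar_circF v t
  · intro t _ x hx; exact circF_axis v t hx
  · intro t ht x; exact abs_circF_le_of_axisBound hDax ht x
  · intro t ht x; exact fderiv_circF_eR_nonneg hsm hsign ht x
  · intro t ht
    have e : (fun (x : EuclideanSpace ℝ (Fin 3)) => if t < 0 then angularMeanVec (v t) x else 0) =
        angularMeanVec (v t) := by funext x; simp only [if_pos ht]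
    show ContDiff ℝ (⊤ : ℕ∞) (fun (x : EuclideanSpace ℝ (Fin 3)) => if t < 0 then angularMeanVec (v t) x else 0)
    rw [e]; exact contDiff_angularMeanVec_slice hsm ht
  · intro t ht
    have e : (fun (x : EuclideanSpace ℝ (Fin 3)) => if t < 0 then angularMeanVec (v t) x else 0) =
        angularMeanVec (v t) := by funext x; simp only [if_pos ht]
    show VectorCalculus.IsDivFree (fun (x : EuclideanSpace ℝ (Fin 3)) => if t < 0 then angularMeanVec (v t) x else 0)
    rw [e]; exact isDivFree_angularMeanVec hsm hdiv ht
  · intro t ht x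
    simp only [if_pos ht]
    exact cylRadius_mul_norm_angularMeanVec_le hDax ht x
  · intro t ht x
    have h := hβle t ht x
    have hsq : 0 < Real.sqrt (-t) := Real.sqrt_pos.2 (by linarith)
    have hr := cylRadius_nonneg x
    calc |β t x| * cylRadius x ≤ A / (cylRadius x + Real.sqrt (-t)) * cylRadius x :=
          mul_le_mul_of_nonneg_right h hr
      _ ≤ A := by
          rw [div_mul_eq_mul_div, div_le_iff₀ (by positivity)]
          nlinarith
  · intro t ht x
    have h := hβle t ht x
    have hsq : 0 < Real.sqrt (-t) := Real.sqrt_pos.2 (by linarith)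
    have hr := cylRadius_nonneg x
    rw [zero_sub]
    calc |β t x| * Real.sqrt (-t) ≤ A / (cylRadius x + Real.sqrt (-t)) * Real.sqrt (-t) :=
          mul_le_mul_of_nonneg_right h hsq.le
      _ ≤ A := by
          rw [div_mul_eq_mul_div, div_le_iff₀ (by positivity)]
          nlinarith
  · intro x hx s t hst ht
    exact circF_eqn_drift hrate hcont hmild hdiv hβR hx hst ht

/-- **EDDY-TORQUE CENSUS THEOREM.**  A profile of the door's Type-I ancient Oseen-mild class (Type-I time rate, continuity
on the open slab, unit-viscosity Oseen–Duhamel identity, divergence-free slices) with the AXIS-Type-I bound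
`‖v(t,x)‖ ≤ D/(|x_h| + √(−t))` and the closed-hemisphere sign `⟪curl v, e₃⟫ ≥ 0`, whose fluctuation REMAINDER
`ℛ(r,z,s) = ∮_{S(r,z)} [(v_z − v̄_z) ω_r − (v_r − v̄_r) ω₃] dl` (the eddy torque on the axis circle; zero for axisymmetric
fields) is slaved to the circle-integrated vertical vorticity, `|ℛ| ≤ A/(r + √(−s)) · ∮_{S(r,z)} ω₃ dl` for all `r > 0`,
`z`, `s < 0`, is POLOIDAL: `⟪curl v, e₃⟫ ≡ 0` on the slab — the conclusion of the open stub `HemisphereLiouvilleE3` on this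
stratum.  (KNSS 2009 Thm 5.3 for the disc circulation with drift `⟨v⟩_θ` and extra radial drift `−ℛ/∮ω₃`; then
`Γ ≡ 0 ⇒ ∮ω₃ dl ≡ 0 ⇒ ω₃ = 0` on the open half-space `{y₁ > 0}` of every slice, and unique continuation by analyticity.) -/
theorem inner_curl_e3_eq_zero_of_axisTypeI_remainder_le (C D A : ℝ)
    (v : ℝ → EuclideanSpace ℝ (Fin 3) → EuclideanSpace ℝ (Fin 3))
    (hrate : HasTypeITimeDecay C v)
    (hcont : ContinuousOn (uncurry v) (Iio (0 : ℝ) ×ˢ univ))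
    (hmild : ∀ s t : ℝ, s < t → t < 0 → ∀ x,
      v t x = UnboundedOperators.heatExtension (v s) (t - s) x - oseenDuhamel 1 s v v t x)
    (hdiv : ∀ t < 0, VectorCalculus.IsDivFree (v t))
    (hDax : ∀ t < 0, ∀ x : EuclideanSpace ℝ (Fin 3), ‖v t x‖ ≤ D / (cylRadius x + Real.sqrt (-t)))
    (hsign : ∀ s < 0, ∀ y, 0 ≤ ⟪curl (v s) y, (EuclideanSpace.single (2 : Fin 3) (1 : ℝ))⟫_ℝ)
    (hA : 0 ≤ A)
    (hrem : ∀ s < 0, ∀ r : ℝ, 0 < r → ∀ z : ℝ,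
      |remainder v r z s| ≤ A / (r + Real.sqrt (-s)) * vortCirc v r z s) :
    ∀ s < 0, ∀ y, ⟪curl (v s) y, (EuclideanSpace.single (2 : Fin 3) (1 : ℝ))⟫_ℝ = 0 := by
  have hsm : IsSmoothSpaceTimeOn (Iio (0 : ℝ)) v := isSmoothSpaceTimeOn_of_class hrate hcont hmild hdiv
  have hsign' : SignE3 v := hsign
  -- the remainder bound on the axis itself (both sides vanish there)
  have hrem' : ∀ s < 0, ∀ x : EuclideanSpace ℝ (Fin 3), |remainder v (cylRadius x) (x 2) s| ≤
      A / (cylRadius x + Real.sqrt (-s)) * vortCirc v (cylRadius x) (x 2) s := by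
    intro s hs x
    rcases (cylRadius_nonneg x).eq_or_lt with h0 | hpos
    · rw [← h0, vortCirc_zero, mul_zero, remainder_eq hsm hs, vortCirc_zero]
      simp [radVortCirc, circleTerm]
    · exact hrem s hs (cylRadius x) hpos (x 2)
  -- the extra radial drift `β = −ℛ / ∮ω₃` (zero off the slab), jointly measurable
  set Slab : Set (ℝ × EuclideanSpace ℝ (Fin 3)) := {p | p.1 < 0} with hSlab
  have hSlabm : MeasurableSet Slab := measurableSet_lt measurable_fst measurable_const
  set Rf : ℝ × EuclideanSpace ℝ (Fin 3) → ℝ := fun p => remainder v (cylRadius p.2) (p.2 2) p.1 with hRf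
  set Df : ℝ × EuclideanSpace ℝ (Fin 3) → ℝ := fun p => vortCirc v (cylRadius p.2) (p.2 2) p.1 with hDf
  have hq2 : Continuous fun p : ℝ × EuclideanSpace ℝ (Fin 3) => p.2 2 :=
    (PiLp.continuous_apply 2 (fun _ : Fin 3 => ℝ) (2 : Fin 3)).comp continuous_snd
  have hq : Continuous fun p : ℝ × EuclideanSpace ℝ (Fin 3) => ((cylRadius p.2, p.2 2, p.1) : ℝ × ℝ × ℝ) :=
    (continuous_cylRadius.comp continuous_snd).prodMk (hq2.prodMk continuous_fst)
  have hmaps : MapsTo (fun p : ℝ × EuclideanSpace ℝ (Fin 3) => ((cylRadius p.2, p.2 2, p.1) : ℝ × ℝ × ℝ)) Slab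
      {q : ℝ × ℝ × ℝ | q.2.2 < 0} := fun p hp => hp
  have hRc : ContinuousOn Rf Slab := by
    have h := (continuousOn_remainder hsm).comp hq.continuousOn hmaps
    simpa only [Function.comp_def] using h
  have hDc : ContinuousOn Df Slab := by
    have h := (continuousOn_vortCirc hsm).comp hq.continuousOn hmaps
    simpa only [Function.comp_def] using h
  have hRm : Measurable (Slab.piecewise Rf 0) := hRc.measurable_piecewise continuousOn_const hSlabm
  have hDm : Measurable (Slab.piecewise Df 0) := hDc.measurable_piecewise continuousOn_const hSlabm
  set β : ℝ → EuclideanSpace ℝ (Fin 3) → ℝ := fun s x => -(Slab.piecewise Rf 0 (s, x)) / Slab.piecewise Df 0 (s, x) with hβ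
  have hβm : Measurable (uncurry β) := by
    have e : uncurry β = fun p => -(Slab.piecewise Rf 0 p) / Slab.piecewise Df 0 p := by
      funext p; rfl
    rw [e]; exact hRm.neg.div hDm
  have hβval : ∀ s < 0, ∀ x : EuclideanSpace ℝ (Fin 3),
      β s x = -remainder v (cylRadius x) (x 2) s / vortCirc v (cylRadius x) (x 2) s := by
    intro s hs x
    have hmem : ((s, x) : ℝ × EuclideanSpace ℝ (Fin 3)) ∈ Slab := hs
    show -(Slab.piecewise Rf 0 (s, x)) / Slab.piecewise Df 0 (s, x) = _
    rw [Set.piecewise_eq_of_mem _ _ _ hmem, Set.piecewise_eq_of_mem _ _ _ hmem]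
  -- pointwise: `β ∮ω₃ = −ℛ` and `|β| ≤ A/(r+√(−s))`
  have hvort : ∀ s < 0, ∀ x : EuclideanSpace ℝ (Fin 3), 0 ≤ vortCirc v (cylRadius x) (x 2) s :=
    fun s hs x => vortCirc_nonneg v hsign' hs (cylRadius_nonneg x) _
  have hβR : ∀ s < 0, ∀ x : EuclideanSpace ℝ (Fin 3),
      β s x * vortCirc v (cylRadius x) (x 2) s = -remainder v (cylRadius x) (x 2) s := by
    intro s hs x
    rw [hβval s hs x]
    by_cases h0 : vortCirc v (cylRadius x) (x 2) s = 0
    · have h := hrem' s hs x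
      rw [h0, mul_zero] at h
      rw [h0, mul_zero, eq_comm, neg_eq_zero]
      exact abs_nonpos_iff.1 h
    · field_simp
  have hβle : ∀ s < 0, ∀ x : EuclideanSpace ℝ (Fin 3), |β s x| ≤ A / (cylRadius x + Real.sqrt (-s)) := by
    intro s hs x
    have hsq : 0 < Real.sqrt (-s) := Real.sqrt_pos.2 (by linarith)
    have hnn : 0 ≤ A / (cylRadius x + Real.sqrt (-s)) := by
      have := cylRadius_nonneg x; positivity
    rw [hβval s hs x]
    by_cases h0 : vortCirc v (cylRadius x) (x 2) s = 0
    · rw [h0, div_zero, abs_zero]; exact hnn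
    have hpos : 0 < vortCirc v (cylRadius x) (x 2) s := lt_of_le_of_ne (hvort s hs x) (Ne.symm h0)
    rw [abs_div, abs_neg, abs_of_pos hpos, div_le_iff₀ hpos]
    exact hrem' s hs x
  -- the sourced swirl triple and its Liouville theorem: `F ≡ 0`
  have hS := isSourcedSwirl_circF_drift hrate hcont hmild hdiv hDax hsign' hA hβm hβR hβle
  have hFnn : ∀ t < 0, ∀ x : EuclideanSpace ℝ (Fin 3), 0 ≤ (2 * Real.pi)⁻¹ * circ v (cylRadius x) (x 2) t := by
    intro t ht x
    have hv1 : ContDiff ℝ 1 (v t) := (hsm.contDiff_slice ht).of_le (by norm_cast)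
    exact mul_nonneg (by positivity) (circ_nonneg (v := v) hv1 hsign' ht (cylRadius_nonneg x) _)
  have hF0 := IsSourcedSwirl.eq_zero_of_nonneg hS hFnn
  -- `Γ ≡ 0` for `r ≥ 0`, hence `∮ω₃ dl ≡ 0` for `r > 0`
  have hcirc : ∀ s < 0, ∀ r : ℝ, 0 ≤ r → ∀ z : ℝ, circ v r z s = 0 := by
    intro s hs r hr z
    have h := hF0 s hs (cylPt r 0 z)
    rw [cylRadius_cylPt hr] at h
    have hz : (cylPt r 0 z) 2 = z := by simp [cylPt]
    rw [hz] at h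
    have hπ : (2 * Real.pi)⁻¹ ≠ 0 := by positivity
    exact (mul_eq_zero.1 h).resolve_left hπ
  have hvort0 : ∀ s < 0, ∀ r : ℝ, 0 < r → ∀ z : ℝ, vortCirc v r z s = 0 := by
    intro s hs r hr z
    have hv1 : ContDiff ℝ 1 (v s) := (hsm.contDiff_slice hs).of_le (by norm_cast)
    have hev : (fun r' => circ v r' z s) =ᶠ[𝓝 r] fun _ => (0 : ℝ) := by
      filter_upwards [Ioi_mem_nhds hr] with r' hr'
      exact hcirc s hs r' (le_of_lt hr') z
    rw [← deriv_circ_eq_vortCirc v hv1 r z, hev.deriv_eq, deriv_const]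
  -- `ω₃ = 0` on the open half-space `{y₁ > 0}` of every slice
  set O : Set (ℝ × EuclideanSpace ℝ (Fin 3)) := Iio (0 : ℝ) ×ˢ {y | 0 < y 1} with hO
  have hOopen : IsOpen O := isOpen_Iio.prod (isOpen_lt continuous_const (EuclideanSpace.proj (1 : Fin 3)).continuous)
  have hOne : O.Nonempty := ⟨(-1, EuclideanSpace.single (1 : Fin 3) (1 : ℝ)), mk_mem_prod (by norm_num) (by simp)⟩
  have hOsub : O ⊆ Iio (0 : ℝ) ×ˢ univ := prod_mono Subset.rfl (subset_univ _)
  have hzero : ∀ p ∈ O, ⟪curl (v p.1) p.2, HalfSpaceWindowDoorCirculationCarryingRigidityDefs.e3⟫_ℝ = 0 := by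
    rintro ⟨s, y⟩ ⟨hs, hy⟩
    have hs' : s < 0 := hs
    have hy' : 0 < y 1 := hy
    have hv1 : ContDiff ℝ 1 (v s) := (hsm.contDiff_slice hs').of_le (by norm_cast)
    obtain ⟨r, θ, hr, -, hθ, hyeq⟩ := exists_cylPt_eq hy'
    have hωc : Continuous fun θ' => ⟪curl (v s) (cylPt r θ' (y 2)), e3⟫_ℝ * r :=
      (((continuous_curl hv1).comp (continuous_cylPt_θ r (y 2))).inner continuous_const).mul continuous_const
    have hnn : ∀ θ', 0 ≤ ⟪curl (v s) (cylPt r θ' (y 2)), e3⟫_ℝ * r :=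
      fun θ' => mul_nonneg (hsign' s hs' _) hr.le
    have hint : ∫ θ' in (0 : ℝ)..(2 * Real.pi), ⟪curl (v s) (cylPt r θ' (y 2)), e3⟫_ℝ * r = 0 := hvort0 s hs' r hr (y 2)
    have h := eq_zero_of_integral_eq_zero_of_nonneg hωc hnn hint hθ
    rw [hyeq] at h
    show ⟪curl (v s) y, e3⟫_ℝ = 0
    exact (mul_eq_zero.1 h).resolve_right hr.ne'
  -- unique continuation (joint analyticity of `ω₃` on the slab)
  exact inner_curl_e3_eq_zero_of_open hrate hcont hmild hOopen hOne hOsub hzero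

/-- **Corollary (space–time Type-I subclass `HasTypeIDecay D v`)**: the space–time bound implies the axis bound. -/
theorem inner_curl_e3_eq_zero_of_hasTypeIDecay_remainder_le (C D A : ℝ)
    (v : ℝ → EuclideanSpace ℝ (Fin 3) → EuclideanSpace ℝ (Fin 3))
    (hrate : HasTypeITimeDecay C v)
    (hcont : ContinuousOn (uncurry v) (Iio (0 : ℝ) ×ˢ univ))
    (hmild : ∀ s t : ℝ, s < t → t < 0 → ∀ x,
      v t x = UnboundedOperators.heatExtension (v s) (t - s) x - oseenDuhamel 1 s v v t x)
    (hdiv : ∀ t < 0, VectorCalculus.IsDivFree (v t)) (hD : HasTypeIDecay D v)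
    (hsign : ∀ s < 0, ∀ y, 0 ≤ ⟪curl (v s) y, (EuclideanSpace.single (2 : Fin 3) (1 : ℝ))⟫_ℝ)
    (hA : 0 ≤ A)
    (hrem : ∀ s < 0, ∀ r : ℝ, 0 < r → ∀ z : ℝ,
      |remainder v r z s| ≤ A / (r + Real.sqrt (-s)) * vortCirc v r z s) :
    ∀ s < 0, ∀ y, ⟪curl (v s) y, (EuclideanSpace.single (2 : Fin 3) (1 : ℝ))⟫_ℝ = 0 :=
  inner_curl_e3_eq_zero_of_axisTypeI_remainder_le C D A v hrate hcont hmild hdiv (axisBound_of_hasTypeIDecay hD)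
    hsign hA hrem

/-- **Corollary (EDDY-TORQUE-FREE profiles are poloidal)**: `ℛ ≡ 0` on the axis circles (e.g. axisymmetric swirl `v_θ`,
arbitrary non-axisymmetric `v_r, v_z`) ⇒ a closed-hemisphere axis-Type-I profile of the class is poloidal. -/
theorem inner_curl_e3_eq_zero_of_axisTypeI_remainder_eq_zero (C D : ℝ)
    (v : ℝ → EuclideanSpace ℝ (Fin 3) → EuclideanSpace ℝ (Fin 3))
    (hrate : HasTypeITimeDecay C v)
    (hcont : ContinuousOn (uncurry v) (Iio (0 : ℝ) ×ˢ univ))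
    (hmild : ∀ s t : ℝ, s < t → t < 0 → ∀ x,
      v t x = UnboundedOperators.heatExtension (v s) (t - s) x - oseenDuhamel 1 s v v t x)
    (hdiv : ∀ t < 0, VectorCalculus.IsDivFree (v t))
    (hDax : ∀ t < 0, ∀ x : EuclideanSpace ℝ (Fin 3), ‖v t x‖ ≤ D / (cylRadius x + Real.sqrt (-t)))
    (hsign : ∀ s < 0, ∀ y, 0 ≤ ⟪curl (v s) y, (EuclideanSpace.single (2 : Fin 3) (1 : ℝ))⟫_ℝ)
    (hrem : ∀ s < 0, ∀ r : ℝ, 0 < r → ∀ z : ℝ, remainder v r z s = 0) :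
    ∀ s < 0, ∀ y, ⟪curl (v s) y, (EuclideanSpace.single (2 : Fin 3) (1 : ℝ))⟫_ℝ = 0 :=
  inner_curl_e3_eq_zero_of_axisTypeI_remainder_le C D 0 v hrate hcont hmild hdiv hDax hsign le_rfl
    fun s hs r hr z => by rw [hrem s hs r hr z, abs_zero, zero_div, zero_mul]

end Summit.NavierStokesRegularity.NavierStokesRegularity.Theorems.HalfSpaceWindowDoorCirculationCarryingRigidityEddyTorqueLiouville

end
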